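import Summits.QuantumFields.QCD.Theses.SpectralDefectExtinction
import Summits.QuantumFields.QCD.Theorems.ExtinctionBuildsQCD.Negative.WithoutTightCollapse
import Summits.QuantumFields.QCD.Theorems.ExtinctionBuildsQCD.Negative.VolumeLeverBox
import Literature.MathematicalPhysics.QuantumFieldTheory.QCDPhaseQuenched
import Literature.MathematicalPhysics.QuantumFieldTheory.SpectralDefectDensity
import Literature.MathematicalPhysics.QuantumLattice.OverlapLocality
import Summits.QuantumFields.QCD.Theorems.SpectralDefectExtinctionExtinctionBuildsQCDStubSchemeVolumeTransferRel

/-!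
# Stub `stub_schemeVolumeTransfer` (S4) of line `clean-reference-determinant-locality` — the kernel half
(crux `Summit.QuantumFields.QCD.Theses.SpectralDefectExtinction.ExtinctionBuildsQCD`, item stmt-QuantumFields-8968)

**Honest − phase-quenched → 0 at the scheme's own side, reduced to SIGN-DEFECT REGULARITY.** At one torus,
with `W = det D/|det D|` the determinant sign, `N(U) = ∫dψ̄dψ (∏Φ) e^{−ψ̄Dψ}` the Berezin numerator and
`ε_o = ±1` the orientation sign (`∫dψ̄dψ e^{−ψ̄Dψ} = ε_o det D`):
`honest = ∫N dμ_W / (ε_o ∫det D dμ_W)` and `⟨N/(ε_o det D)⟩₊ = ∫ W N dμ_W / (ε_o ∫|det D| dμ_W)`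
(`qcdPhaseQuenchedExpect_div_fermiBoltzmann`), so that
`‖honest − PQ‖ ≤ 2δ + 4ε‖PQ‖` as soon as `‖∫det D − ∫|det D|‖ ≤ 2ε∫|det D|` (EXTINCT at `S = L_k`:
`det D = |det D|` on the clean event) and `‖∫N − ∫W N‖ = ‖∫(1 − W)N‖ ≤ δ ∫|det D|`
(`norm_honest_sub_phaseQuenched_le`). Along a subsequence on which the phase-quenched functions are
bounded this gives `honest − PQ → 0` (`tendsto_honest_sub_phaseQuenched`), and the registered stub with the
ONE extra hypothesis "sign-defect regularity of the numerator along `φ`"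
(`stub_schemeVolumeTransfer_of_signDefectRegularity`, sorry-free). The extra hypothesis is NOT derivable from
the registered hypotheses (S1, S2, `SD⁺`, S3, PQ convergence): see `StubSchemeVolumeTransfer.md`.
-/

noncomputable section

namespace Summit.QuantumFields.QCD.Cruxes.ExtinctionBuildsQCD.CleanReferenceDeterminantLocality

open scoped BigOperators Topology ENNReal SchwartzMap Matrix Classical
open MeasureTheory Filter
open Literature.MathematicalPhysics.QuantumFieldTheory Literature.MathematicalPhysics.QuantumLattice
  Literature.Probability.LatticeModels Literature.MathematicalPhysics.AQFT
open Summit.QuantumFields.QCD.Theses.SpectralDefectExtinction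
open Summit.QuantumFields.QCD.Theorems.ExtinctionBuildsQCD.Negative
open Summit.QuantumFields.QCD.Cruxes.ExtinctionBuildsQCD.DilutionBuysLocalRarity

section PerTorus

variable {Nf : ℕ} {S : ℕ} [NeZero S]

/-- **The phase-quenched weight times the Berezin ratio is the sign-reweighted numerator**:
`|det D(U)| • (x / ∫dψ̄dψ e^{−ψ̄D(U)ψ}) = ε_o⁻¹ · W(U) · x` (both sides `0` where `det D(U) = 0`). -/
theorem norm_det_smul_div_fermiBoltzmann (U : GaugeConfig 4 S SU3) (mq : Fin Nf → ℝ) (x : ℂ) :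
    ‖(diracMatrix U mq).det‖ • (x / fermiIntegral (fermiBoltzmann U mq)) =
      ((-1 : ℂ) ^ (Fintype.card (FermiIdx Nf S) * (Fintype.card (FermiIdx Nf S) - 1) / 2 +
          Fintype.card (FermiIdx Nf S)))⁻¹ * (qcdDetPhase U mq * x) := by
  set es : ℂ := (-1 : ℂ) ^ (Fintype.card (FermiIdx Nf S) * (Fintype.card (FermiIdx Nf S) - 1) / 2 +
    Fintype.card (FermiIdx Nf S)) with hes
  have hes0 : es ≠ 0 := fermiOrientationSign_ne_zero _
  have hdet := det_diracMatrix_eq_ofReal_re U mq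
  have hn := norm_det_diracMatrix_eq_abs_re U mq
  rw [qcdDetPhase_eq_sign, fermiIntegral_fermiBoltzmann, ← hes, hn]
  generalize (diracMatrix U mq).det.re = r at hdet ⊢
  rw [hdet, Complex.real_smul]
  rcases lt_trichotomy r 0 with h | rfl | h
  · have hr : (r : ℂ) ≠ 0 := Complex.ofReal_ne_zero.2 h.ne
    rw [abs_of_neg h, sign_neg h, SignType.coe_neg_one, Complex.ofReal_neg, Complex.ofReal_neg,
      Complex.ofReal_one]
    field_simp
  · simp
  · have hr : (r : ℂ) ≠ 0 := Complex.ofReal_ne_zero.2 h.ne'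
    rw [abs_of_pos h, sign_pos h, SignType.coe_one, Complex.ofReal_one, one_mul]
    field_simp

/-- **`⟨N/∫dψ̄dψ e^{−ψ̄Dψ}⟩₊ = ∫ W N dμ_W / (ε_o ∫ |det D| dμ_W)`**: the phase-quenched expectation of a Berezin
ratio is the sign-reweighted numerator over the phase-quenched partition function (no a.e. hypothesis on
`det D ≠ 0`: where `det D = 0` both the ratio and `W` are junk `0`). -/
theorem qcdPhaseQuenchedExpect_div_fermiBoltzmann (β : ℝ) (mq : Fin Nf → ℝ) (F : GaugeConfig 4 S SU3 → ℂ) :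
    qcdPhaseQuenchedExpect β S mq (fun U => F U / fermiIntegral (fermiBoltzmann U mq)) =
      (((∫ U, ‖(diracMatrix U mq).det‖ ∂(wilsonMeasure (d := 4) (L := S) (fundamentalRep (Fin 3)) β))⁻¹ : ℝ) : ℂ) *
        (((-1 : ℂ) ^ (Fintype.card (FermiIdx Nf S) * (Fintype.card (FermiIdx Nf S) - 1) / 2 +
            Fintype.card (FermiIdx Nf S)))⁻¹ *
          ∫ U, qcdDetPhase U mq * F U ∂(wilsonMeasure (d := 4) (L := S) (fundamentalRep (Fin 3)) β)) := by
  rw [qcdPhaseQuenchedExpect_def]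
  simp_rw [norm_det_smul_div_fermiBoltzmann]
  rw [integral_const_mul, Complex.real_smul]

/-- Pointwise: off the clean event the signed and the phase-quenched weights differ by at most twice the
defect number times the weight; on it they agree. -/
theorem norm_det_sub_norm_le {Nn : GaugeConfig 4 S SU3 → ℕ} (mq : Fin Nf → ℝ)
    (hpos : ∀ U, Nn U = 0 → (diracMatrix U mq).det = ↑‖(diracMatrix U mq).det‖) (U : GaugeConfig 4 S SU3) :
    ‖(diracMatrix U mq).det - ↑‖(diracMatrix U mq).det‖‖ ≤ 2 * ((Nn U : ℝ) * ‖(diracMatrix U mq).det‖) := by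
  by_cases h : Nn U = 0
  · rw [← hpos U h, sub_self, norm_zero]; positivity
  · have h1 : (1 : ℝ) ≤ Nn U := by exact_mod_cast Nat.one_le_iff_ne_zero.2 h
    calc ‖(diracMatrix U mq).det - ↑‖(diracMatrix U mq).det‖‖
        ≤ ‖(diracMatrix U mq).det‖ + ‖((‖(diracMatrix U mq).det‖ : ℝ) : ℂ)‖ := norm_sub_le _ _
      _ = 2 * (1 * ‖(diracMatrix U mq).det‖) := by rw [Complex.norm_real, norm_norm]; ring
      _ ≤ 2 * ((Nn U : ℝ) * ‖(diracMatrix U mq).det‖) := by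
          gcongr

/-- **The signed partition function is within twice the defect mass of the phase-quenched one**:
`‖∫ det D dμ − ∫ |det D| dμ‖ ≤ 2 ∫ N |det D| dμ` for a bounded measurable count `N` on whose zero set
`det D = |det D|`. -/
theorem norm_integral_det_sub_integral_norm_le (μ : Measure (GaugeConfig 4 S SU3)) [IsFiniteMeasure μ]
    (mq : Fin Nf → ℝ) {Nn : GaugeConfig 4 S SU3 → ℕ} (hNm : Measurable Nn) {M : ℕ} (hNb : ∀ U, Nn U ≤ M)
    (hpos : ∀ U, Nn U = 0 → (diracMatrix U mq).det = ↑‖(diracMatrix U mq).det‖) :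
    ‖(∫ U, (diracMatrix U mq).det ∂μ) - ↑(∫ U, ‖(diracMatrix U mq).det‖ ∂μ)‖ ≤
      2 * ∫ U, (Nn U : ℝ) * ‖(diracMatrix U mq).det‖ ∂μ := by
  obtain ⟨Cd, hCd⟩ := exists_norm_det_diracMatrix_le (S := S) mq
  have hdm : Measurable fun U : GaugeConfig 4 S SU3 => (diracMatrix U mq).det :=
    (continuous_det_diracMatrix mq).measurable
  have hdet_int : Integrable (fun U => (diracMatrix U mq).det) μ :=
    Integrable.of_bound hdm.aestronglyMeasurable Cd (Eventually.of_forall hCd)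
  have hN_int := integrable_natCast_mul_norm_det μ mq hNm hNb
  have h2 : Integrable (fun U => ((‖(diracMatrix U mq).det‖ : ℝ) : ℂ)) μ :=
    (integrable_norm_det_diracMatrix mq μ).ofReal
  rw [← integral_complex_ofReal, ← integral_sub hdet_int h2, ← integral_const_mul]
  refine (norm_integral_le_integral_norm _).trans
    (integral_mono (hdet_int.sub h2).norm (hN_int.const_mul 2) fun U => ?_)
  exact norm_det_sub_norm_le mq hpos U

/-- **The per-torus estimate: honest − phase-quenched in terms of the defect mass and the sign-defective
numerator.** For a numerator functional `F`, a bounded measurable count `N` on whose zero set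
`det D = |det D|`, if `∫ N |det D| ≤ ε ∫ |det D|` (`ε ≤ 1/4`) and `‖∫ F − ∫ W F‖ ≤ δ ∫ |det D|`, then
`‖∫F/∫(ε_o det D) − ⟨F/(ε_o det D)⟩₊‖ ≤ 2δ + 4ε‖⟨F/(ε_o det D)⟩₊‖` (junk case `∫|det D| = 0`: both are `0`). -/
theorem norm_honest_sub_phaseQuenched_le (β : ℝ) (mq : Fin Nf → ℝ) (F : GaugeConfig 4 S SU3 → ℂ)
    {Nn : GaugeConfig 4 S SU3 → ℕ} (hNm : Measurable Nn) {M : ℕ} (hNb : ∀ U, Nn U ≤ M)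
    (hpos : ∀ U, Nn U = 0 → (diracMatrix U mq).det = ↑‖(diracMatrix U mq).det‖)
    {ε δ : ℝ} (hε0 : 0 ≤ ε) (hε4 : ε ≤ 1 / 4) (hδ : 0 ≤ δ)
    (hrare : ∫ U, (Nn U : ℝ) * ‖(diracMatrix U mq).det‖ ∂(wilsonMeasure (d := 4) (L := S) (fundamentalRep (Fin 3)) β) ≤
      ε * ∫ U, ‖(diracMatrix U mq).det‖ ∂(wilsonMeasure (d := 4) (L := S) (fundamentalRep (Fin 3)) β))
    (hsign : ‖(∫ U, F U ∂(wilsonMeasure (d := 4) (L := S) (fundamentalRep (Fin 3)) β)) -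
        ∫ U, qcdDetPhase U mq * F U ∂(wilsonMeasure (d := 4) (L := S) (fundamentalRep (Fin 3)) β)‖ ≤
      δ * ∫ U, ‖(diracMatrix U mq).det‖ ∂(wilsonMeasure (d := 4) (L := S) (fundamentalRep (Fin 3)) β)) :
    ‖(∫ U, F U ∂(wilsonMeasure (d := 4) (L := S) (fundamentalRep (Fin 3)) β)) /
          (∫ U, fermiIntegral (fermiBoltzmann U mq) ∂(wilsonMeasure (d := 4) (L := S) (fundamentalRep (Fin 3)) β)) -
        qcdPhaseQuenchedExpect β S mq (fun U => F U / fermiIntegral (fermiBoltzmann U mq))‖ ≤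
      2 * δ + 4 * ε * ‖qcdPhaseQuenchedExpect β S mq (fun U => F U / fermiIntegral (fermiBoltzmann U mq))‖ := by
  set μ := wilsonMeasure (d := 4) (L := S) (fundamentalRep (Fin 3)) β with hμ
  set es : ℂ := (-1 : ℂ) ^ (Fintype.card (FermiIdx Nf S) * (Fintype.card (FermiIdx Nf S) - 1) / 2 +
    Fintype.card (FermiIdx Nf S)) with hes
  have hes0 : es ≠ 0 := fermiOrientationSign_ne_zero _
  have hes1 : ‖es‖ = 1 := by rw [hes, norm_pow, norm_neg, norm_one, one_pow]
  set Z : ℝ := ∫ U, ‖(diracMatrix U mq).det‖ ∂μ with hZ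
  set B : ℂ := ∫ U, (diracMatrix U mq).det ∂μ with hB
  set A : ℂ := ∫ U, F U ∂μ with hA
  set AW : ℂ := ∫ U, qcdDetPhase U mq * F U ∂μ with hAW
  have hZ0 : 0 ≤ Z := integral_nonneg fun U => norm_nonneg _
  have hG : (∫ U, fermiIntegral (fermiBoltzmann U mq) ∂μ) = es * B := by
    rw [hB, ← integral_const_mul]
    exact integral_congr_ae (Eventually.of_forall fun U => fermiIntegral_fermiBoltzmann U mq)
  have hP : qcdPhaseQuenchedExpect β S mq (fun U => F U / fermiIntegral (fermiBoltzmann U mq)) =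
      ((Z⁻¹ : ℝ) : ℂ) * (es⁻¹ * AW) := qcdPhaseQuenchedExpect_div_fermiBoltzmann β mq F
  have hBZ : ‖B - (Z : ℂ)‖ ≤ 2 * (ε * Z) :=
    (norm_integral_det_sub_integral_norm_le μ mq hNm hNb hpos).trans (by linarith)
  have hPn : ‖qcdPhaseQuenchedExpect β S mq (fun U => F U / fermiIntegral (fermiBoltzmann U mq))‖ = Z⁻¹ * ‖AW‖ := by
    rw [hP, norm_mul, norm_mul, norm_inv, hes1, inv_one, one_mul, Complex.norm_real, Real.norm_eq_abs,
      abs_of_nonneg (inv_nonneg.2 hZ0)]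
  rw [hPn, hG, hP]
  rcases hZ0.eq_or_lt with hZz | hZpos
  · -- junk case: `∫ |det D| = 0`, hence `∫ det D = 0`; both quotients vanish
    have hZz' : Z = 0 := hZz.symm
    have hB0 : B = 0 := by simpa [hZz'] using hBZ
    simp only [hB0, hZz', mul_zero, div_zero, inv_zero, Complex.ofReal_zero, zero_mul, sub_zero, norm_zero,
      add_zero]
    positivity
  · have hBn : Z / 2 ≤ ‖B‖ := by
      have h1 : ‖(Z : ℂ)‖ - ‖B‖ ≤ ‖B - (Z : ℂ)‖ := by rw [norm_sub_rev]; exact norm_sub_norm_le _ _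
      rw [Complex.norm_real, Real.norm_eq_abs, abs_of_pos hZpos] at h1
      nlinarith
    have hB0 : 0 < ‖B‖ := by linarith
    have hBne : B ≠ 0 := norm_pos_iff.1 hB0
    have hZne : (Z : ℂ) ≠ 0 := Complex.ofReal_ne_zero.2 hZpos.ne'
    have key : A / (es * B) - ((Z⁻¹ : ℝ) : ℂ) * (es⁻¹ * AW) =
        es⁻¹ * (((A - AW) + AW / (Z : ℂ) * ((Z : ℂ) - B)) / B) := by
      rw [Complex.ofReal_inv]
      field_simp
      ring
    rw [key, norm_mul, norm_inv, hes1, inv_one, one_mul, norm_div, div_le_iff₀ hB0]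
    have hAWZ : ‖AW / (Z : ℂ)‖ = Z⁻¹ * ‖AW‖ := by
      rw [norm_div, Complex.norm_real, Real.norm_eq_abs, abs_of_pos hZpos, div_eq_inv_mul]
    calc ‖(A - AW) + AW / (Z : ℂ) * ((Z : ℂ) - B)‖
        ≤ ‖A - AW‖ + ‖AW / (Z : ℂ)‖ * ‖(Z : ℂ) - B‖ := (norm_add_le _ _).trans (by rw [norm_mul])
      _ ≤ δ * Z + Z⁻¹ * ‖AW‖ * (2 * (ε * Z)) := by
          rw [hAWZ]
          exact add_le_add hsign (mul_le_mul_of_nonneg_left (by rwa [norm_sub_rev])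
            (mul_nonneg (inv_nonneg.2 hZpos.le) (norm_nonneg _)))
      _ ≤ (2 * δ + 4 * ε * (Z⁻¹ * ‖AW‖)) * ‖B‖ := by
          have hP0 : 0 ≤ Z⁻¹ * ‖AW‖ := mul_nonneg (inv_nonneg.2 hZpos.le) (norm_nonneg _)
          have h1 : δ * (Z / 2) ≤ δ * ‖B‖ := mul_le_mul_of_nonneg_left hBn hδ
          have h2 : 2 * ε * (Z⁻¹ * ‖AW‖) * (Z / 2) ≤ 2 * ε * (Z⁻¹ * ‖AW‖) * ‖B‖ :=
            mul_le_mul_of_nonneg_left hBn (mul_nonneg (mul_nonneg zero_le_two hε0) hP0)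
          generalize Z⁻¹ * ‖AW‖ = P at hP0 h2 ⊢
          generalize ‖B‖ = nB at h1 h2 ⊢
          linarith

end PerTorus

/-- **Honest − phase-quenched → 0 along a subsequence (abstract form).** Along `k ↦ φ k` of a scheme `sch`,
for numerator functionals `F j` and bounded measurable counts `N j` on whose zero sets `det D = |det D|`: if
the defect mass and the SIGN-DEFECTIVE numerators `∫ F − ∫ W F = ∫ (1 − W) F` are both `o(∫ |det D| dμ_W)`
along `φ` and the phase-quenched Berezin ratios `⟨F/(ε_o det D)⟩₊` stay bounded along `φ`, then
`∫F/∫(ε_o det D) − ⟨F/(ε_o det D)⟩₊ → 0` along `φ`. -/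
theorem tendsto_honest_sub_phaseQuenched {Nf : ℕ} (sch : QCDScheme Nf) (φ : ℕ → ℕ)
    (F : ∀ j, GaugeConfig 4 (sch.side j) SU3 → ℂ) (Nn : ∀ j, GaugeConfig 4 (sch.side j) SU3 → ℕ)
    (hNm : ∀ j, Measurable (Nn j)) (hNb : ∀ j, ∃ M : ℕ, ∀ U, Nn j U ≤ M)
    (hpos : ∀ j U, Nn j U = 0 →
      (diracMatrix U fun fl => sch.mq fl j).det = ↑‖(diracMatrix U fun fl => sch.mq fl j).det‖)
    (hrare : ∀ ε : ℝ, 0 < ε → ∀ᶠ k in atTop,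
      ∫ U, (Nn (φ k) U : ℝ) * ‖(diracMatrix U fun fl => sch.mq fl (φ k)).det‖ ∂(qcdGaugeMeasure sch (φ k)) ≤
        ε * ∫ U, ‖(diracMatrix U fun fl => sch.mq fl (φ k)).det‖ ∂(qcdGaugeMeasure sch (φ k)))
    (hsign : ∀ ε : ℝ, 0 < ε → ∀ᶠ k in atTop,
      ‖(∫ U, F (φ k) U ∂(qcdGaugeMeasure sch (φ k))) -
          ∫ U, qcdDetPhase U (fun fl => sch.mq fl (φ k)) * F (φ k) U ∂(qcdGaugeMeasure sch (φ k))‖ ≤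
        ε * ∫ U, ‖(diracMatrix U fun fl => sch.mq fl (φ k)).det‖ ∂(qcdGaugeMeasure sch (φ k)))
    (hbdd : ∃ K : ℝ, ∀ᶠ k in atTop,
      ‖qcdPhaseQuenchedExpect (sch.β (φ k)) (sch.side (φ k)) (fun fl => sch.mq fl (φ k))
        (fun U => F (φ k) U / fermiIntegral (fermiBoltzmann U fun fl => sch.mq fl (φ k)))‖ ≤ K) :
    Tendsto (fun k => (∫ U, F (φ k) U ∂(qcdGaugeMeasure sch (φ k))) /
        (∫ U, fermiIntegral (fermiBoltzmann U fun fl => sch.mq fl (φ k)) ∂(qcdGaugeMeasure sch (φ k))) -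
      qcdPhaseQuenchedExpect (sch.β (φ k)) (sch.side (φ k)) (fun fl => sch.mq fl (φ k))
        (fun U => F (φ k) U / fermiIntegral (fermiBoltzmann U fun fl => sch.mq fl (φ k)))) atTop (𝓝 0) := by
  obtain ⟨K, hK⟩ := hbdd
  rw [Metric.tendsto_nhds]
  intro η hη
  have hK0 : 0 < max K 0 + 1 := by positivity
  set ε : ℝ := min (1 / 4) (η / (16 * (max K 0 + 1))) with hεdef
  have hε : 0 < ε := lt_min (by norm_num) (by positivity)
  have hδ : 0 < η / 8 := by positivity
  filter_upwards [hrare ε hε, hsign (η / 8) hδ, hK] with k hRk hSk hKk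
  obtain ⟨M, hM⟩ := hNb (φ k)
  rw [dist_zero_right]
  have hKk' : ‖qcdPhaseQuenchedExpect (sch.β (φ k)) (sch.side (φ k)) (fun fl => sch.mq fl (φ k))
      (fun U => F (φ k) U / fermiIntegral (fermiBoltzmann U fun fl => sch.mq fl (φ k)))‖ ≤ max K 0 + 1 :=
    hKk.trans ((le_max_left _ _).trans (le_add_of_nonneg_right zero_le_one))
  refine (norm_honest_sub_phaseQuenched_le (sch.β (φ k)) (fun fl => sch.mq fl (φ k)) (F (φ k)) (hNm (φ k)) hM
    (hpos (φ k)) hε.le (min_le_left _ _) hδ.le hRk hSk).trans_lt ?_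
  have h1 : 4 * ε * ‖qcdPhaseQuenchedExpect (sch.β (φ k)) (sch.side (φ k)) (fun fl => sch.mq fl (φ k))
      (fun U => F (φ k) U / fermiIntegral (fermiBoltzmann U fun fl => sch.mq fl (φ k)))‖ ≤ η / 4 :=
    calc 4 * ε * ‖qcdPhaseQuenchedExpect (sch.β (φ k)) (sch.side (φ k)) (fun fl => sch.mq fl (φ k))
          (fun U => F (φ k) U / fermiIntegral (fermiBoltzmann U fun fl => sch.mq fl (φ k)))‖
        ≤ 4 * (η / (16 * (max K 0 + 1))) * (max K 0 + 1) :=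
          mul_le_mul (mul_le_mul_of_nonneg_left (min_le_right _ _) (by norm_num)) hKk' (norm_nonneg _)
            (by positivity)
      _ = η / 4 := by field_simp; ring
  linarith

/-- **S4 with the ONE missing input made a hypothesis (kernel half, sorry-free): the SCHEME-VOLUME TRANSFER
from SIGN-DEFECT REGULARITY.** The registered signature of `stub_schemeVolumeTransfer` verbatim, plus — for the
given off-diagonal insertion string `(n, σ, f)` — the hypothesis that along `φ` the sign-defective part of the honest
Berezin numerator, `∫ (1 − W) N dμ_W = 2∫_{det D<0} N + ∫_{det D=0} N`, is `o(∫ |det D| dμ_W)`. Of the registered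
hypotheses only `0 ≤ M₀ < m`, `0 < c`, EXTINCT (at `S = L_{φ k}`, via `eventually_defectMass_le`) and the
phase-quenched convergence for THIS string (boundedness of `⟨R⟩₊`) are used; S1, S2, S3, TIGHT, the volume window
and the branch clause are inert. -/
theorem stub_schemeVolumeTransfer_of_signDefectRegularity :
    ∀ Nf : ℕ, Nf = 2 ∨ Nf = 3 →
      (∃ μ C : ℝ, 0 < μ ∧ 0 < C ∧ ∀ (L : ℕ) [NeZero L] (U : GaugeConfig 4 L SU3) (m₀ g : ℝ),
        0 < g → g ≤ 1 →
        (∀ ψ : QuarkIdx L → ℂ, g ^ 2 * ∑ i, ‖ψ i‖ ^ 2 ≤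
            ∑ i, ‖(wilsonDirac (fundamentalRep (Fin 3)) U m₀ 1 *ᵥ ψ) i‖ ^ 2) →
        ∀ (x y : TorusSite 4 L) (i j : Fin 3 × Fin 4),
          ‖(wilsonDirac (fundamentalRep (Fin 3)) U m₀ 1)⁻¹ (x, i) (y, j)‖ ≤
            C / g * Real.exp (-(μ * g * (torusTaxiDist x y : ℝ)))) →
      (∀ (ι : Type) [Fintype ι] [DecidableEq ι] (S : Finset ι) (D D' : Matrix ι ι ℂ),
        IsUnit D'.det → (∀ i j, i ∉ S ∨ j ∉ S → D i j = D' i j) →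
          D.det = D'.det *
            ((1 : Matrix S S ℂ) + (D'⁻¹.submatrix Subtype.val Subtype.val) *
              ((D - D').submatrix Subtype.val Subtype.val)).det) →
      ∀ (reg : QCDRegularisation Nf) (M₀ c : ℝ),
        (reg.HasMassScaling ∧ (reg.scheme 0 0 0).HasAsymptoticScaling ∧ 0 ≤ M₀ ∧ 0 < c ∧
          (∀ m : Fin Nf → ℝ, (∀ f, M₀ < m f) → Extinct Nf reg c m ∧ Tight Nf reg M₀ m) ∧
          (∃ p q : ℕ, 0 < q ∧ ∀ᶠ k in atTop,
            (reg.a k)⁻¹ ≤ (reg.a k * reg.L k) ^ q ∧ (reg.L k : ℝ) ≤ (reg.a k)⁻¹ ^ p) ∧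
          (∀ᶠ k in atTop, -1 < reg.mcrit k)) →
        (∃ R : ℕ, ∀ m : Fin Nf → ℝ, (∀ f, M₀ < m f) → ∀ ε : ℝ, 0 < ε → ∀ᶠ k in atTop, ∀ S : ℕ, reg.L k ≤ S →
          qcdPhaseQuenchedExpect (reg.β k) (2 * S + 1) (fun fl => reg.mcrit k + reg.a k * m fl / reg.Zm k)
              (fun U => ((sInf {n : ℕ | n = (2 * S + 1) ^ 4 ∨
                ∃ cs : Finset (Literature.Probability.LatticeModels.Site 4), cs.card ≤ n ∧
                  ∃ U' : GaugeConfig 4 (2 * S + 1) SU3,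
                    (∀ (x : TorusSite 4 (2 * S + 1)) (μ : Fin 4),
                      (∀ ctr ∈ cs, x ∉ torusBox (2 * S + 1) ctr R) → U' (x, μ) = U (x, μ)) ∧
                    ∀ fl : Fin Nf,
                      Multiset.countP (fun z : ℂ => z.im = 0 ∧ z.re < -(reg.mcrit k + reg.a k * m fl / reg.Zm k))
                          (wilsonDirac (fundamentalRep (Fin 3)) U' 0 1).charpoly.roots = 0 ∧
                      Multiset.countP (fun z : ℂ => |z.re| < c * (reg.a k * m fl / reg.Zm k))
                          (spinorLift gammaFive *
                            wilsonDirac (fundamentalRep (Fin 3)) U' (reg.mcrit k + reg.a k * m fl / reg.Zm k) 1).charpoly.roots = 0} : ℕ) : ℝ)) ≤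
            ε * ((2 * S + 1 : ℝ) / (2 * reg.L k + 1)) ^ 4) →
        ∀ m : Fin Nf → ℝ, (∀ f, M₀ < m f) → ∀ (z shift : QCDField Nf → ℕ → ℝ) (φ : ℕ → ℕ), StrictMono φ →
          (∃ T : OSData (QCDField Nf) 4, ∀ (n : ℕ), n ≠ 0 → ∀ (σ : Fin n → QCDField Nf)
              (f : Fin n → 𝓢(EuclideanSpace ℝ (Fin 4), ℝ)) (F : 𝓢((Fin n → EuclideanSpace ℝ (Fin 4)), ℂ)),
              IsTensorOf F (fun i => ofRealTest (f i)) → IsOffDiagonal F →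
              Tendsto (fun k : ℕ => qcdPhaseQuenchedExpect ((reg.scheme m z shift).β (φ k)) ((reg.scheme m z shift).side (φ k)) (fun fl => (reg.scheme m z shift).mq fl (φ k)) (fun U => (fermiIntegral ((List.ofFn fun i => smearedInsertion (reg.scheme m z shift) (φ k) U (σ i) (f i)).prod * fermiBoltzmann U fun fl => (reg.scheme m z shift).mq fl (φ k)) / fermiIntegral (fermiBoltzmann U fun fl => (reg.scheme m z shift).mq fl (φ k))))) atTop (𝓝 (T.schwinger n σ F))) →
          ∀ (n : ℕ), n ≠ 0 → ∀ (σ : Fin n → QCDField Nf) (f : Fin n → 𝓢(EuclideanSpace ℝ (Fin 4), ℝ))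
            (F : 𝓢((Fin n → EuclideanSpace ℝ (Fin 4)), ℂ)), IsTensorOf F (fun i => ofRealTest (f i)) → IsOffDiagonal F →
            (∀ ε : ℝ, 0 < ε → ∀ᶠ k : ℕ in atTop,
              ‖(∫ U, fermiIntegral ((List.ofFn fun i => smearedInsertion (reg.scheme m z shift) (φ k) U (σ i) (f i)).prod * fermiBoltzmann U fun fl => (reg.scheme m z shift).mq fl (φ k)) ∂(qcdGaugeMeasure (reg.scheme m z shift) (φ k))) -
                  ∫ U, qcdDetPhase U (fun fl => (reg.scheme m z shift).mq fl (φ k)) * fermiIntegral ((List.ofFn fun i => smearedInsertion (reg.scheme m z shift) (φ k) U (σ i) (f i)).prod * fermiBoltzmann U fun fl => (reg.scheme m z shift).mq fl (φ k)) ∂(qcdGaugeMeasure (reg.scheme m z shift) (φ k))‖ ≤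
                ε * ∫ U, ‖(diracMatrix U fun fl => (reg.scheme m z shift).mq fl (φ k)).det‖ ∂(qcdGaugeMeasure (reg.scheme m z shift) (φ k))) →
            Tendsto (fun k : ℕ =>
              qcdLatticeSchwinger (reg.scheme m z shift) (φ k) n σ f -
                qcdPhaseQuenchedExpect ((reg.scheme m z shift).β (φ k)) ((reg.scheme m z shift).side (φ k)) (fun fl => (reg.scheme m z shift).mq fl (φ k)) (fun U => (fermiIntegral ((List.ofFn fun i => smearedInsertion (reg.scheme m z shift) (φ k) U (σ i) (f i)).prod * fermiBoltzmann U fun fl => (reg.scheme m z shift).mq fl (φ k)) / fermiIntegral (fermiBoltzmann U fun fl => (reg.scheme m z shift).mq fl (φ k)))))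
              atTop (𝓝 0) := by
  intro Nf _ _ _ reg M₀ c hSD _ m hm z shift φ hφ hPQ n hn σ f F hF hoff hsign
  obtain ⟨-, -, hM₀, hc, hET, -, -⟩ := hSD
  have hm0 : ∀ fl, 0 < m fl := fun fl => hM₀.trans_lt (hm fl)
  have hE : Extinct Nf reg c m := (hET m hm).1
  obtain ⟨T, hT⟩ := hPQ
  have hconv := hT n hn σ f F hF hoff
  refine tendsto_honest_sub_phaseQuenched (reg.scheme m z shift) φ
    (fun j U => fermiIntegral ((List.ofFn fun i => smearedInsertion (reg.scheme m z shift) j U (σ i) (f i)).prod *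
      fermiBoltzmann U fun fl => (reg.scheme m z shift).mq fl j))
    (fun j U => (∑ g : Fin Nf, (Multiset.countP (fun z : ℂ => z.im = 0 ∧ z.re < -(reg.mcrit j + reg.a j * m g / reg.Zm j)) (wilsonDirac (fundamentalRep (Fin 3)) U 0 1).charpoly.roots + Multiset.countP (fun z : ℂ => |z.re| < c * (reg.a j * m g / reg.Zm j)) (spinorLift gammaFive * wilsonDirac (fundamentalRep (Fin 3)) U (reg.mcrit j + reg.a j * m g / reg.Zm j) 1).charpoly.roots)))
    ?_ ?_ ?_ ?_ hsign ?_
  · exact fun j => Finset.measurable_sum _ fun g _ =>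
      (measurable_signDefectCount _).add (measurable_coercivityDefectCount _ _)
  · exact fun j => ⟨∑ _g : Fin Nf, (Fintype.card (QuarkIdx ((reg.scheme m z shift).side j)) +
        Fintype.card (QuarkIdx ((reg.scheme m z shift).side j))),
      fun U => Finset.sum_le_sum fun g _ =>
        add_le_add (countP_roots_charpoly_le_card _ _) (countP_roots_charpoly_le_card _ _)⟩
  · exact fun j U hU => det_diracMatrix_eq_norm_of_clean reg hc hm0 j U hU
  · exact fun ε hε => hφ.tendsto_atTop.eventually (eventually_defectMass_le reg c m z shift hE hε)
  · refine ⟨‖T.schwinger n σ F‖ + 1, ?_⟩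
    filter_upwards [Metric.tendsto_nhds.1 hconv 1 one_pos] with k hk
    rw [dist_eq_norm] at hk
    linarith [norm_sub_norm_le (qcdPhaseQuenchedExpect ((reg.scheme m z shift).β (φ k)) ((reg.scheme m z shift).side (φ k)) (fun fl => (reg.scheme m z shift).mq fl (φ k)) (fun U => (fermiIntegral ((List.ofFn fun i => smearedInsertion (reg.scheme m z shift) (φ k) U (σ i) (f i)).prod * fermiBoltzmann U fun fl => (reg.scheme m z shift).mq fl (φ k)) / fermiIntegral (fermiBoltzmann U fun fl => (reg.scheme m z shift).mq fl (φ k))))) (T.schwinger n σ F)]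

end Summit.QuantumFields.QCD.Cruxes.ExtinctionBuildsQCD.CleanReferenceDeterminantLocality

end
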